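import Summits.Ventures.Crystal3D.Theorems.StickyWulffConstantPolycrystalWulffBoundInclinedLamellarSections
import Literature.Analysis.Convexity.OpenHPolytope
import HarnessLib

/-!
# TB-D assembly, part 2: COPLANAR FACETS of disjoint pieces on one side of a plane are a.e. disjoint — facet areas ADD UP
# (lane T, crux `TextureLiminfV5`, stmt-Ventures-23912; design memo TB-D-0 §4 (D)/(C)/(R), §7)

HONEST FRAMING. Venture `Summits/Ventures/Crystal3D` (cell `crystal3d-full`), route `route-Ventures-StickyWulffConstant`, helper `--supports` the
law-v5 crux `TextureLiminfV5` (stmt-Ventures-23912).  Elementary convex geometry (census-free, standard axioms); nothing about any cover or mesh;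
F-C1 not moved.

WHY.  The piece ledger (`energy_le_pieceLedger`, …TextureBuildPieceEnergy) books costs facet by facet, PIECE by piece; the budgets of the mesh
(`gapCost`'s designated facets, a wall cell's cut polygon, a riser curtain) are areas of ONE planar region `R` shared by MANY pieces lying on the
same side of its plane.  To compare, one needs `Σ_pieces facetArea (cl P_i ∩ R) ≤ facetArea R`, i.e. that the traces of pairwise disjoint open
convex pieces on a common supporting plane overlap only in null sets.  This file proves it:
* `prism_decomp_unique` — points of a prism over a planar set decompose uniquely as `y + t·n`;
* `exists_disc_subset_of_volume_prism_ne_zero` — a planar convex set whose prism has non-zero volume contains a planar disc (the prism is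
  a convex set, so it has interior; no charts);
* `exists_below_disc_mem` — the CONE ARGUMENT: an open convex set on the side `{⟪n,x⟫ < c₀}` whose closure contains a planar disc around `y₀`
  contains `y₀ − ε n` for all small `ε > 0`;
* **`facetArea_inter_eq_zero_of_sameSide`** — two DISJOINT open `H`-polytopes on the same open side of a plane have traces on it meeting in
  a set of zero `facetArea`;
* **`sum_facetArea_inter_le_of_sameSide`** — hence for finitely many such pieces and a closed bounded planar region `R`:
  `Σ_i facetArea (cl P_i ∩ R) n ≤ facetArea R n`.
-/

noncomputable section

namespace Summit.Ventures.Crystal3D.Cruxes.TextureLiminf.TexShadow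

open Summit.Ventures.Crystal3D Summit.Ventures.Crystal3D.Theorems MeasureTheory Set
open scoped InnerProductSpace
open Literature.Analysis.Convexity (convex_openHPolytope isOpen_openHPolytope)

/-! ### Prisms over planar sets -/

/-- Unique decomposition `y + t·n` over a plane with unit normal `n`. -/
theorem prism_decomp_unique {n : E3} (hn : ‖n‖ = 1) {c₀ : ℝ} {y y' : E3} (hy : ⟪n, y⟫_ℝ = c₀)
    (hy' : ⟪n, y'⟫_ℝ = c₀) {t t' : ℝ} (h : y + t • n = y' + t' • n) : y = y' ∧ t = t' := by
  have hnn : ⟪n, n⟫_ℝ = 1 := by rw [real_inner_self_eq_norm_sq, hn, one_pow]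
  have ht : t = t' := by
    have h' := congrArg (fun z => ⟪n, z⟫_ℝ) h
    simp only [inner_add_right, real_inner_smul_right, hy, hy', hnn, mul_one] at h'
    linarith
  refine ⟨?_, ht⟩
  rw [ht] at h
  exact add_right_cancel h

/-- The prism over a set is the image of `F × [0,1]` under `(y,t) ↦ y + t·n`. -/
theorem prism_eq_image (F : Set E3) (n : E3) :
    {x : E3 | ∃ y ∈ F, ∃ t ∈ Set.Icc (0 : ℝ) 1, x = y + t • n} =
      (fun q : E3 × ℝ => q.1 + q.2 • n) '' (F ×ˢ Set.Icc (0 : ℝ) 1) := by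
  ext x
  simp only [mem_setOf_eq, mem_image, mem_prod, Prod.exists]
  constructor
  · rintro ⟨y, hy, t, ht, rfl⟩
    exact ⟨y, t, ⟨hy, ht⟩, rfl⟩
  · rintro ⟨y, t, ⟨hy, ht⟩, rfl⟩
    exact ⟨y, hy, t, ht, rfl⟩

/-- The prism over a compact set is compact. -/
theorem isCompact_prism {F : Set E3} (hF : IsCompact F) (n : E3) :
    IsCompact {x : E3 | ∃ y ∈ F, ∃ t ∈ Set.Icc (0 : ℝ) 1, x = y + t • n} := by
  rw [prism_eq_image]
  exact (hF.prod isCompact_Icc).image ((continuous_fst).add (continuous_snd.smul continuous_const))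

/-- A planar convex set of positive `facetArea` contains a planar disc. -/
theorem exists_disc_subset_of_volume_prism_ne_zero {n : E3} (hn : ‖n‖ = 1) {c₀ : ℝ} {D : Set E3}
    (hD : Convex ℝ D) (hDpl : D ⊆ {x : E3 | ⟪n, x⟫_ℝ = c₀})
    (hpos : volume {x : E3 | ∃ y ∈ D, ∃ t ∈ Set.Icc (0 : ℝ) 1, x = y + t • n} ≠ 0) :
    ∃ y₀ ∈ D, ∃ r : ℝ, 0 < r ∧ Metric.ball y₀ r ∩ {x : E3 | ⟪n, x⟫_ℝ = c₀} ⊆ D := by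
  set T : Set E3 := {x : E3 | ∃ y ∈ D, ∃ t ∈ Set.Icc (0 : ℝ) 1, x = y + t • n} with hT
  have hTconv : Convex ℝ T := by
    rintro x ⟨y, hy, t, ht, rfl⟩ x' ⟨y', hy', t', ht', rfl⟩ a b ha hb hab
    refine ⟨a • y + b • y', hD hy hy' ha hb hab, a * t + b * t',
      ⟨by nlinarith [ht.1, ht'.1], by nlinarith [ht.2, ht'.2]⟩, ?_⟩
    simp only [smul_add, smul_smul, add_smul]
    abel
  have hTint : (interior T).Nonempty := by
    by_contra hemp
    rw [Set.not_nonempty_iff_eq_empty] at hemp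
    have hspan : affineSpan ℝ T ≠ ⊤ := by
      intro htop
      have h := (hTconv.interior_nonempty_iff_affineSpan_eq_top).2 htop
      rw [hemp] at h
      exact Set.not_nonempty_empty h
    exact hpos (measure_mono_null (subset_affineSpan ℝ T) (Measure.addHaar_affineSubspace volume _ hspan))
  obtain ⟨w, hw⟩ := hTint
  obtain ⟨r, hr, hball⟩ := Metric.isOpen_iff.1 isOpen_interior w hw
  have hballT : Metric.ball w r ⊆ T := hball.trans interior_subset
  obtain ⟨y₀, hy₀, t₀, -, hw₀⟩ := hballT (Metric.mem_ball_self hr)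
  refine ⟨y₀, hy₀, r, hr, ?_⟩
  rintro y ⟨hy, hypl⟩
  have hmem : w + (y - y₀) ∈ Metric.ball w r := by
    rw [Metric.mem_ball, dist_eq_norm, add_sub_cancel_left, ← dist_eq_norm]
    exact hy
  obtain ⟨y', hy', t', -, hEq⟩ := hballT hmem
  rw [hw₀, show y₀ + t₀ • n + (y - y₀) = y + t₀ • n by abel] at hEq
  obtain ⟨hyy', -⟩ := prism_decomp_unique hn hypl (hDpl hy') hEq
  rw [hyy']
  exact hy'

/-- **The cone argument.**  An open convex set on the side `{⟪n,x⟫ < c₀}` whose closure contains the planar disc of radius `r` around `y₀`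
contains `y₀ − ε·n` for all small `ε > 0`. -/
theorem exists_below_disc_mem {n : E3} (hn : ‖n‖ = 1) {c₀ : ℝ} {P : Set E3} (hP : Convex ℝ P) (ho : IsOpen P)
    (hs : P ⊆ {x : E3 | ⟪n, x⟫_ℝ < c₀}) (hne : P.Nonempty) {y₀ : E3} (hy₀ : ⟪n, y₀⟫_ℝ = c₀) {r : ℝ}
    (hr : 0 < r) (hd : Metric.ball y₀ r ∩ {x : E3 | ⟪n, x⟫_ℝ = c₀} ⊆ closure P) :
    ∃ ε₀ : ℝ, 0 < ε₀ ∧ ∀ ε : ℝ, 0 < ε → ε < ε₀ → y₀ - ε • n ∈ P := by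
  obtain ⟨q, hq⟩ := hne
  have hnn : ⟪n, n⟫_ℝ = 1 := by rw [real_inner_self_eq_norm_sq, hn, one_pow]
  set h : ℝ := c₀ - ⟪n, q⟫_ℝ with hh
  have hpos : 0 < h := by
    have h1 : ⟪n, q⟫_ℝ < c₀ := hs hq
    rw [hh]; linarith
  set L : ℝ := ‖y₀ - q‖ with hL
  have hL0 : 0 ≤ L := norm_nonneg _
  -- the slope constant: ‖y − y₀‖ ≤ ε·M for ε < h/2
  set M : ℝ := 1 + (2 * L + h) / h with hM
  have hMpos : 0 < M := by rw [hM]; positivity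
  refine ⟨min (h / 2) (r / M), lt_min (by linarith) (div_pos hr hMpos), fun ε hε hεlt => ?_⟩
  have hεh : ε < h / 2 := lt_of_lt_of_le hεlt (min_le_left _ _)
  have hεr : ε < r / M := lt_of_lt_of_le hεlt (min_le_right _ _)
  have hεM : ε * M < r := (lt_div_iff₀ hMpos).1 hεr
  set z : E3 := y₀ - ε • n with hz
  set t : ℝ := (h - ε) / h with ht
  have hhe : 0 < h - ε := by linarith
  have ht0 : 0 < t := div_pos hhe hpos
  have ht1 : t < 1 := (div_lt_one hpos).2 (by linarith)
  set y : E3 := q + t⁻¹ • (z - q) with hy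
  -- `y` is on the plane
  have hypl : ⟪n, y⟫_ℝ = c₀ := by
    have hq' : ⟪n, q⟫_ℝ = c₀ - h := by rw [hh]; ring
    rw [hy, inner_add_right, real_inner_smul_right, inner_sub_right, hz, inner_sub_right, real_inner_smul_right,
      hy₀, hnn, hq', ht, inv_div]
    field_simp
    ring
  -- `y` is within `r` of `y₀`
  have hydiff : y - y₀ = (t⁻¹ - 1) • (z - q) - ε • n := by
    simp only [hy, hz, sub_smul, one_smul]
    abel
  have htinv : t⁻¹ - 1 = ε / (h - ε) := by
    rw [ht, inv_div]
    field_simp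
    ring
  have hzq : ‖z - q‖ ≤ L + ε := by
    rw [hz, show y₀ - ε • n - q = (y₀ - q) - ε • n by abel]
    calc ‖y₀ - q - ε • n‖ ≤ ‖y₀ - q‖ + ‖ε • n‖ := norm_sub_le _ _
      _ = L + ε := by rw [hL, norm_smul, Real.norm_eq_abs, abs_of_pos hε, hn, mul_one]
  have hcoef : ε / (h - ε) ≤ 2 * ε / h := by
    rw [div_le_div_iff₀ hhe hpos]
    nlinarith
  have hydist : dist y y₀ < r := by
    rw [dist_eq_norm, hydiff, htinv]
    calc ‖(ε / (h - ε)) • (z - q) - ε • n‖ ≤ ‖(ε / (h - ε)) • (z - q)‖ + ‖ε • n‖ := norm_sub_le _ _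
      _ = ε / (h - ε) * ‖z - q‖ + ε := by
          rw [norm_smul, norm_smul, Real.norm_eq_abs, Real.norm_eq_abs, abs_of_pos (div_pos hε hhe),
            abs_of_pos hε, hn, mul_one]
      _ ≤ 2 * ε / h * (L + ε) + ε := by
          have h1 : ε / (h - ε) * ‖z - q‖ ≤ 2 * ε / h * (L + ε) :=
            mul_le_mul hcoef hzq (norm_nonneg _) (by positivity)
          linarith
      _ ≤ ε * M := by
          rw [hM]
          have h2 : 2 * ε / h * (L + ε) ≤ 2 * ε / h * (L + h / 2) :=
            mul_le_mul_of_nonneg_left (by linarith) (by positivity)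
          have h3 : 2 * ε / h * (L + h / 2) = ε * ((2 * L + h) / h) := by
            field_simp
          nlinarith
      _ < r := hεM
  have hycl : y ∈ closure P := hd ⟨Metric.mem_ball.2 hydist, hypl⟩
  -- `z = (1 − t) q + t y` lies in the open segment from `q ∈ P` to `y ∈ cl P`
  have hzcombo : (1 - t) • q + t • y = z := by
    simp only [hy, smul_add, smul_smul, mul_inv_cancel₀ ht0.ne', one_smul, sub_smul]
    abel
  have hzint : z ∈ interior P := by
    rw [← hzcombo]
    exact hP.combo_interior_closure_mem_interior (by rwa [ho.interior_eq]) hycl (by linarith) ht0.le (by ring)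
  exact interior_subset hzint

/-! ### Coplanar facets of disjoint pieces -/

/-- **Two disjoint open `H`-polytopes on the same open side of a plane have a.e.-disjoint traces on it**: the prism over
`cl P₁ ∩ cl P₂ ∩ {⟪n,x⟫ = c₀}` is a null set. -/
theorem volume_prism_inter_eq_zero_of_sameSide {n : E3} (hn : ‖n‖ = 1) {c₀ : ℝ} {H₁ H₂ : Finset (E3 × ℝ)}
    (hs₁ : polytope H₁ ⊆ {x : E3 | ⟪n, x⟫_ℝ < c₀}) (hs₂ : polytope H₂ ⊆ {x : E3 | ⟪n, x⟫_ℝ < c₀})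
    (hd : Disjoint (polytope H₁) (polytope H₂)) :
    volume {x : E3 | ∃ y ∈ closure (polytope H₁) ∩ closure (polytope H₂) ∩ {x : E3 | ⟪n, x⟫_ℝ = c₀},
      ∃ t ∈ Set.Icc (0 : ℝ) 1, x = y + t • n} = 0 := by
  by_contra hne
  -- both pieces are nonempty (else the trace is empty)
  have hne₁ : (polytope H₁).Nonempty := by
    by_contra h
    rw [Set.not_nonempty_iff_eq_empty] at h
    apply hne
    rw [h, closure_empty, Set.empty_inter, Set.empty_inter]
    simp
  have hne₂ : (polytope H₂).Nonempty := by
    by_contra h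
    rw [Set.not_nonempty_iff_eq_empty] at h
    apply hne
    rw [h, closure_empty, Set.inter_empty, Set.empty_inter]
    simp
  have hpl : Convex ℝ {x : E3 | ⟪n, x⟫_ℝ = c₀} := by
    intro x hx y hy a b ha hb hab
    simp only [mem_setOf_eq, inner_add_right, real_inner_smul_right] at hx hy ⊢
    rw [hx, hy, ← add_mul, hab, one_mul]
  have hDconv : Convex ℝ (closure (polytope H₁) ∩ closure (polytope H₂) ∩ {x : E3 | ⟪n, x⟫_ℝ = c₀}) :=
    ((convex_openHPolytope H₁).closure.inter (convex_openHPolytope H₂).closure).inter hpl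
  obtain ⟨y₀, hy₀, r, hr, hdisc⟩ :=
    exists_disc_subset_of_volume_prism_ne_zero hn hDconv (fun x hx => hx.2) hne
  obtain ⟨ε₁, hε₁, h₁⟩ := exists_below_disc_mem hn (convex_openHPolytope H₁) (isOpen_openHPolytope H₁) hs₁
    hne₁ hy₀.2 hr (fun x hx => (hdisc hx).1.1)
  obtain ⟨ε₂, hε₂, h₂⟩ := exists_below_disc_mem hn (convex_openHPolytope H₂) (isOpen_openHPolytope H₂) hs₂
    hne₂ hy₀.2 hr (fun x hx => (hdisc hx).1.2)
  set ε : ℝ := min ε₁ ε₂ / 2 with hε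
  have hmin : 0 < min ε₁ ε₂ := lt_min hε₁ hε₂
  have hεpos : 0 < ε := by rw [hε]; exact div_pos hmin two_pos
  have hεlt₁ : ε < ε₁ := by rw [hε]; linarith [min_le_left ε₁ ε₂]
  have hεlt₂ : ε < ε₂ := by rw [hε]; linarith [min_le_right ε₁ ε₂]
  exact hd.le_bot ⟨h₁ ε hεpos hεlt₁, h₂ ε hεpos hεlt₂⟩

/-- The `facetArea` form of `volume_prism_inter_eq_zero_of_sameSide`. -/
theorem facetArea_inter_eq_zero_of_sameSide {n : E3} (hn : ‖n‖ = 1) {c₀ : ℝ} {H₁ H₂ : Finset (E3 × ℝ)}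
    (hs₁ : polytope H₁ ⊆ {x : E3 | ⟪n, x⟫_ℝ < c₀}) (hs₂ : polytope H₂ ⊆ {x : E3 | ⟪n, x⟫_ℝ < c₀})
    (hd : Disjoint (polytope H₁) (polytope H₂)) :
    facetArea (closure (polytope H₁) ∩ closure (polytope H₂) ∩ {x : E3 | ⟪n, x⟫_ℝ = c₀}) n = 0 := by
  unfold facetArea
  rw [volume_prism_inter_eq_zero_of_sameSide hn hs₁ hs₂ hd, ENNReal.toReal_zero]

/-- **Facet areas of disjoint pieces on one side of a plane add up inside any closed bounded planar region `R`.** -/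
theorem sum_facetArea_inter_le_of_sameSide {ι : Type*} (s : Finset ι) (H : ι → Finset (E3 × ℝ)) {n : E3}
    (hn : ‖n‖ = 1) {c₀ : ℝ} (hs : ∀ i ∈ s, polytope (H i) ⊆ {x : E3 | ⟪n, x⟫_ℝ < c₀})
    (hd : ∀ i ∈ s, ∀ j ∈ s, i ≠ j → Disjoint (polytope (H i)) (polytope (H j)))
    {R : Set E3} (hR : R ⊆ {x : E3 | ⟪n, x⟫_ℝ = c₀}) (hRc : IsClosed R) (hRb : Bornology.IsBounded R) :
    ∑ i ∈ s, facetArea (closure (polytope (H i)) ∩ R) n ≤ facetArea R n := by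
  classical
  set T : ι → Set E3 := fun i =>
    {x : E3 | ∃ y ∈ closure (polytope (H i)) ∩ R, ∃ t ∈ Set.Icc (0 : ℝ) 1, x = y + t • n} with hT
  set TR : Set E3 := {x : E3 | ∃ y ∈ R, ∃ t ∈ Set.Icc (0 : ℝ) 1, x = y + t • n} with hTR
  have hRcpt : IsCompact R := Metric.isCompact_of_isClosed_isBounded hRc hRb
  have hTmeas : ∀ i, MeasurableSet (T i) := fun i =>
    (isCompact_prism (hRcpt.inter_left isClosed_closure) n).isClosed.measurableSet
  have hTsub : (⋃ i ∈ s, T i) ⊆ TR := by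
    intro x hx
    obtain ⟨i, -, hxi⟩ := mem_iUnion₂.1 hx
    obtain ⟨y, hy, t, ht, rfl⟩ := hxi
    exact ⟨y, hy.2, t, ht, rfl⟩
  have hTRfin : volume TR ≠ ⊤ := volume_prism_ne_top_of_isBounded hRb R subset_closure n
  have hTfin : ∀ i, volume (T i) ≠ ⊤ := fun i =>
    volume_prism_ne_top_of_isBounded hRb _ (fun y hy => subset_closure hy.2) n
  -- pairwise null intersections
  have hnull : ∀ i ∈ s, ∀ j ∈ s, i ≠ j → volume (T i ∩ T j) = 0 := by
    intro i hi j hj hij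
    refine measure_mono_null ?_ (volume_prism_inter_eq_zero_of_sameSide hn (hs i hi) (hs j hj) (hd i hi j hj hij))
    rintro x ⟨⟨y, hy, t, ht, rfl⟩, ⟨y', hy', t', ht', hEq⟩⟩
    obtain ⟨hyy', -⟩ := prism_decomp_unique hn (hR hy.2) (hR hy'.2) hEq
    exact ⟨y, ⟨⟨hy.1, hyy' ▸ hy'.1⟩, hR hy.2⟩, t, ht, rfl⟩
  have hadd : volume (⋃ i ∈ s, T i) = ∑ i ∈ s, volume (T i) :=
    measure_biUnion_finset₀ (fun i hi j hj hij => hnull i hi j hj hij) (fun i _ => (hTmeas i).nullMeasurableSet)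
  change ∑ i ∈ s, (volume (T i)).toReal ≤ (volume TR).toReal
  rw [← ENNReal.toReal_sum (fun i _ => hTfin i), ← hadd]
  exact ENNReal.toReal_mono hTRfin (measure_mono hTsub)

end Summit.Ventures.Crystal3D.Cruxes.TextureLiminf.TexShadow

end
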